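import Summits.RiemannHypothesis.RiemannHypothesis.Theorems.LiPrimeEchoResonantPhase
import Summits.RiemannHypothesis.RiemannHypothesis.Theorems.LiAsymptoticSmoothReplace
import HarnessLib

/-!
# RiemannHypothesis / LiPrimeEcho — crux K2 `LiPrimeEdgeEcho`, part 6: bounds and polar form of the resonant term (RH-FREE)

RH-FREE [rh-li-prover].  Route `Theses/LiPrimeEcho.lean` (rung «Li PRIME-ECHO LAW» `LiTheory.LiZeroWindowEcho`), item
`LiPrimeEdgeEcho` (stmt-RiemannHypothesis-19245).  For the functions of part 5 (`u, u₁, u₂, h, b, g, P` on the edge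
`w = 3/2 + iy`, `z = (w − 1)/w`): the bounds `1/(2y³) ≤ −u₁ ≤ 3/y³` (`y ≥ 3`), `|u₂| ≤ 19/y⁴`, `0 ≤ h ≤ 1/y²`,
`κ ≤ g ≤ κe` (`y ≥ √n`), `|g'| ≤ 2nκe/y³`, the asymptotics `u < 1/y²`, `u ≥ 1/y² − 4/y⁴`, `|h − u| ≤ 7/y⁴`,
`|y³(−u₁) − 2| ≤ 30/y²`, `|b − 1/y| ≤ 2/y³`, and the polar form `Λ(2) 2^{−w} z⁻ⁿ = g(y) e^{iP(y)}`
(`arg z = b` since `Re z > 0` and `tan(arg z) = Im z/Re z = y/(y² + 3/4)`; `|z| = e^{−h}`).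
Nothing here bears on the truth of RH.
-/

noncomputable section

-- D-0017: `Summit.<S>.<S>.…` is the designed namespace of a single-problem summit.
set_option linter.dupNamespace false

open Complex MeasureTheory intervalIntegral Set
open scoped Real Interval ArithmeticFunction.vonMangoldt

namespace Summit.RiemannHypothesis.RiemannHypothesis.Theorems.LiTheory

namespace PrimeEdge

/-! ### Elementary bounds -/

/-- `−u₁ ≤ 3/y³` (`y > 0`). -/
theorem neg_ub_le {y : ℝ} (hy : 0 < y) : -ub y ≤ 3 / y ^ 3 := by
  rw [ub, neg_sub]
  have h1 : 0 ≤ y / (y ^ 2 + 1 / 4) ^ 2 := by positivity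
  have h2 : 3 * y / (y ^ 2 + 9 / 4) ^ 2 ≤ 3 / y ^ 3 := by
    rw [div_le_div_iff₀ (by positivity) (by positivity)]
    nlinarith [sq_nonneg y, pow_pos hy 3, pow_pos hy 5]
  linarith

/-- `1/(2y³) ≤ −u₁` (`y ≥ 3`). -/
theorem le_neg_ub {y : ℝ} (hy : 3 ≤ y) : 1 / (2 * y ^ 3) ≤ -ub y := by
  have hy0 : 0 < y := by linarith
  rw [ub, neg_sub]
  have h1 : y / (y ^ 2 + 1 / 4) ^ 2 ≤ 1 / y ^ 3 := by
    rw [div_le_div_iff₀ (by positivity) (by positivity)]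
    nlinarith [sq_nonneg y, pow_pos hy0 3, pow_pos hy0 2]
  have h2 : 3 / (2 * y ^ 3) ≤ 3 * y / (y ^ 2 + 9 / 4) ^ 2 := by
    rw [div_le_div_iff₀ (by positivity) (by positivity)]
    have hy2 : 9 ≤ y ^ 2 := by nlinarith
    nlinarith [pow_pos hy0 3, pow_pos hy0 4, mul_nonneg (sub_nonneg.2 hy2) (pow_pos hy0 2).le]
  have : 1 / (2 * y ^ 3) = 3 / (2 * y ^ 3) - 1 / y ^ 3 := by field_simp; ring
  linarith

/-- `|u₂| ≤ 19/y⁴` (`y ≥ 1`). -/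
theorem abs_uc_le {y : ℝ} (hy : 1 ≤ y) : |uc y| ≤ 19 / y ^ 4 := by
  have hy0 : 0 < y := by linarith
  rw [uc]
  have hA : |(1 / 4 - 3 * y ^ 2) / (y ^ 2 + 1 / 4) ^ 3| ≤ 4 / y ^ 4 := by
    rw [abs_div, abs_of_pos (by positivity : (0:ℝ) < (y ^ 2 + 1 / 4) ^ 3), div_le_div_iff₀ (by positivity) (by positivity)]
    have : |1 / 4 - 3 * y ^ 2| ≤ 4 * y ^ 2 := by
      rw [abs_le]; constructor <;> nlinarith
    calc |1 / 4 - 3 * y ^ 2| * y ^ 4 ≤ 4 * y ^ 2 * y ^ 4 := by gcongr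
      _ = 4 * (y ^ 2) ^ 3 := by ring
      _ ≤ 4 * (y ^ 2 + 1 / 4) ^ 3 := by gcongr; linarith
  have hB : |3 * (9 / 4 - 3 * y ^ 2) / (y ^ 2 + 9 / 4) ^ 3| ≤ 15 / y ^ 4 := by
    rw [abs_div, abs_of_pos (by positivity : (0:ℝ) < (y ^ 2 + 9 / 4) ^ 3), div_le_div_iff₀ (by positivity) (by positivity)]
    have : |3 * (9 / 4 - 3 * y ^ 2)| ≤ 15 * y ^ 2 := by
      rw [abs_le]; constructor <;> nlinarith
    calc |3 * (9 / 4 - 3 * y ^ 2)| * y ^ 4 ≤ 15 * y ^ 2 * y ^ 4 := by gcongr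
      _ = 15 * (y ^ 2) ^ 3 := by ring
      _ ≤ 15 * (y ^ 2 + 9 / 4) ^ 3 := by gcongr; linarith
  have : (19 : ℝ) / y ^ 4 = 4 / y ^ 4 + 15 / y ^ 4 := by ring
  rw [this]
  exact (abs_sub _ _).trans (add_le_add hA hB)

/-- `0 ≤ h ≤ 1/y²` (`y > 0`). -/
theorem ha_bounds {y : ℝ} (hy : 0 < y) : 0 ≤ ha y ∧ ha y ≤ 1 / y ^ 2 := by
  have h4 : (0 : ℝ) < y ^ 2 + 1 / 4 := by positivity
  have hq : (y ^ 2 + 9 / 4) / (y ^ 2 + 1 / 4) = 1 + 2 / (y ^ 2 + 1 / 4) := by field_simp; ring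
  rw [ha, hq]
  have hx : 0 ≤ 2 / (y ^ 2 + 1 / 4) := by positivity
  constructor
  · exact mul_nonneg (by norm_num) (Real.log_nonneg (by linarith))
  · have hl : Real.log (1 + 2 / (y ^ 2 + 1 / 4)) ≤ 2 / (y ^ 2 + 1 / 4) := by
      have := Real.log_le_sub_one_of_pos (by linarith : (0:ℝ) < 1 + 2 / (y ^ 2 + 1 / 4)); linarith
    have h2 : 2 / (y ^ 2 + 1 / 4) ≤ 2 / y ^ 2 := div_le_div_of_nonneg_left (by norm_num) (by positivity) (by linarith)
    calc 1 / 2 * Real.log (1 + 2 / (y ^ 2 + 1 / 4)) ≤ 1 / 2 * (2 / y ^ 2) := by gcongr; exact hl.trans h2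
      _ = 1 / y ^ 2 := by ring

/-- `κ ≤ g ≤ κe` for `y ≥ √n`. -/
theorem gA_bounds (n : ℕ) {y : ℝ} (hy : Real.sqrt n ≤ y) (hy0 : 0 < y) : kap ≤ gA n y ∧ gA n y ≤ kap * Real.exp 1 := by
  have hk := kap_pos
  obtain ⟨h0, h1⟩ := ha_bounds hy0
  have hyn : (n : ℝ) ≤ y ^ 2 := by
    have := Real.sq_sqrt (Nat.cast_nonneg n); nlinarith [Real.sqrt_nonneg (n : ℝ)]
  rw [gA]
  constructor
  · have : 1 ≤ Real.exp (n * ha y) := Real.one_le_exp (by positivity)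
    nlinarith
  · refine mul_le_mul_of_nonneg_left (Real.exp_le_exp.2 ?_) hk.le
    calc (n : ℝ) * ha y ≤ n * (1 / y ^ 2) := by gcongr
      _ ≤ 1 := by rw [mul_one_div, div_le_one (by positivity)]; exact hyn

/-- `|g'| ≤ 2n g/y³ ≤ 2nκe/y³` pointwise (`y ≥ √n`, `y > 0`). -/
theorem abs_gA'_le (n : ℕ) {y : ℝ} (hy : Real.sqrt n ≤ y) (hy0 : 0 < y) :
    |-(2 * n * y / Qd y) * gA n y| ≤ 2 * n * (kap * Real.exp 1) / y ^ 3 := by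
  have hQ := Qd_pos y
  have hQ4 := pow_four_le_Qd y
  have hg := (gA_bounds n hy hy0).2
  have hg0 := (gA_pos n y).le
  rw [abs_mul, abs_neg, abs_of_nonneg (by positivity), abs_of_nonneg hg0]
  calc 2 * n * y / Qd y * gA n y ≤ 2 * n * y / y ^ 4 * (kap * Real.exp 1) := by
        gcongr
    _ = 2 * n * (kap * Real.exp 1) / y ^ 3 := by field_simp

/-- `u < 1/y²` (`y > 0`). -/
theorem ua_lt {y : ℝ} (hy : 0 < y) : ua y < 1 / y ^ 2 := by
  rw [ua_eq, Qd, div_lt_div_iff₀ (by positivity) (by positivity)]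
  nlinarith [sq_nonneg y, pow_pos hy 2]

/-- `1/y² − 4/y⁴ ≤ u` (`y ≥ 1`). -/
theorem ua_ge {y : ℝ} (hy : 1 ≤ y) : 1 / y ^ 2 - 4 / y ^ 4 ≤ ua y := by
  have hy0 : 0 < y := by linarith
  have e : 1 / y ^ 2 - 4 / y ^ 4 = (y ^ 2 - 4) / y ^ 4 := by field_simp
  rw [e, ua_eq, Qd, div_le_div_iff₀ (by positivity) (by positivity)]
  have hy2 : 1 ≤ y ^ 2 := by nlinarith
  nlinarith [pow_pos hy0 2, pow_pos hy0 4, mul_nonneg (sub_nonneg.2 hy2) (pow_pos hy0 2).le]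

/-- `|h − u| ≤ 7/y⁴` (`y ≥ 1`). -/
theorem abs_ha_sub_ua_le {y : ℝ} (hy : 1 ≤ y) : |ha y - ua y| ≤ 7 / y ^ 4 := by
  have hy0 : 0 < y := by linarith
  have h4 : (0 : ℝ) < y ^ 2 + 1 / 4 := by positivity
  set x : ℝ := 2 / (y ^ 2 + 1 / 4) with hx
  have hx0 : 0 < x := by positivity
  have hq : (y ^ 2 + 9 / 4) / (y ^ 2 + 1 / 4) = 1 + x := by rw [hx]; field_simp; ring
  -- `x − x² ≤ log(1+x) ≤ x`
  have hup : Real.log (1 + x) ≤ x := by have := Real.log_le_sub_one_of_pos (by linarith : (0:ℝ) < 1 + x); linarith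
  have hlo : x - x ^ 2 ≤ Real.log (1 + x) := by
    have h1 := Real.one_sub_inv_le_log_of_pos (by linarith : (0:ℝ) < 1 + x)
    have h2 : x - x ^ 2 ≤ 1 - (1 + x)⁻¹ := by
      rw [show 1 - (1 + x)⁻¹ = x / (1 + x) by field_simp; ring, le_div_iff₀ (by linarith)]
      nlinarith [sq_nonneg x, mul_pos hx0 hx0]
    linarith
  have hha : |ha y - x / 2| ≤ x ^ 2 / 2 := by
    rw [ha, hq, abs_le]; constructor <;> linarith
  -- `x/2 = 1/(y²+1/4)` vs `1/y²`
  have hx2 : |x / 2 - 1 / y ^ 2| ≤ 1 / (4 * y ^ 4) := by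
    have hx2' : x / 2 = 1 / (y ^ 2 + 1 / 4) := by rw [hx]; ring
    have e : 1 / (y ^ 2 + 1 / 4) - 1 / y ^ 2 = (-(1 / 4)) / ((y ^ 2 + 1 / 4) * y ^ 2) := by
      rw [div_sub_div _ _ (by positivity) (by positivity)]
      congr 1
      ring
    rw [hx2', e, abs_div, abs_neg, abs_of_pos (by norm_num : (0:ℝ) < 1 / 4), abs_of_pos (by positivity),
      div_le_div_iff₀ (by positivity) (by positivity)]
    nlinarith [pow_pos hy0 4, pow_pos hy0 2]
  have hxx : x ^ 2 / 2 ≤ 2 / y ^ 4 := by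
    have e : x ^ 2 / 2 = 2 / (y ^ 2 + 1 / 4) ^ 2 := by
      rw [hx, div_pow, eq_div_iff (by positivity)]
      field_simp
    rw [e]
    have : y ^ 4 ≤ (y ^ 2 + 1 / 4) ^ 2 := by nlinarith [pow_pos hy0 2]
    exact div_le_div_of_nonneg_left (by norm_num) (by positivity) this
  have hua : |ua y - 1 / y ^ 2| ≤ 4 / y ^ 4 := by
    rw [abs_le]; constructor <;> linarith [ua_lt hy0, ua_ge hy]
  have h14 : 1 / (4 * y ^ 4) ≤ 1 / y ^ 4 := div_le_div_of_nonneg_left (by norm_num) (by positivity) (by nlinarith [pow_pos hy0 4])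
  have e3 : ha y - ua y = (ha y - x / 2) + (x / 2 - 1 / y ^ 2) - (ua y - 1 / y ^ 2) := by ring
  rw [e3]
  refine ((abs_sub _ _).trans (add_le_add (abs_add_le _ _) le_rfl)).trans ?_
  have : (7 : ℝ) / y ^ 4 = 2 / y ^ 4 + 1 / y ^ 4 + 4 / y ^ 4 := by ring
  rw [this]
  exact add_le_add (add_le_add (hha.trans hxx) (hx2.trans h14)) hua

/-- `|y³(−u₁) − 2| ≤ 30/y²` (`y ≥ 1`). -/
theorem abs_cube_mul_neg_ub_sub_two_le {y : ℝ} (hy : 1 ≤ y) : |y ^ 3 * (-ub y) - 2| ≤ 30 / y ^ 2 := by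
  have hy0 : 0 < y := by linarith
  have h9 : (0 : ℝ) < y ^ 2 + 9 / 4 := by positivity
  have h4 : (0 : ℝ) < y ^ 2 + 1 / 4 := by positivity
  -- `y³ · 3y/(y²+9/4)² = 3 − 3((9/2)y² + 81/16)/(y²+9/4)²`, `y³ · y/(y²+1/4)² = 1 − (y²/2 + 1/16)/(y²+1/4)²`
  have eA : y ^ 3 * (3 * y / (y ^ 2 + 9 / 4) ^ 2) = 3 - 3 * (9 / 2 * y ^ 2 + 81 / 16) / (y ^ 2 + 9 / 4) ^ 2 := by
    field_simp; ring
  have eB : y ^ 3 * (y / (y ^ 2 + 1 / 4) ^ 2) = 1 - (1 / 2 * y ^ 2 + 1 / 16) / (y ^ 2 + 1 / 4) ^ 2 := by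
    field_simp; ring
  have hA : 3 * (9 / 2 * y ^ 2 + 81 / 16) / (y ^ 2 + 9 / 4) ^ 2 ≤ 29 / y ^ 2 := by
    rw [div_le_div_iff₀ (by positivity) (by positivity)]
    have hy2 : 1 ≤ y ^ 2 := by nlinarith
    nlinarith [pow_pos hy0 2, pow_pos hy0 4, mul_nonneg (sub_nonneg.2 hy2) (pow_pos hy0 2).le]
  have hB : (1 / 2 * y ^ 2 + 1 / 16) / (y ^ 2 + 1 / 4) ^ 2 ≤ 1 / y ^ 2 := by
    rw [div_le_div_iff₀ (by positivity) (by positivity)]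
    nlinarith [pow_pos hy0 2, pow_pos hy0 4]
  have hA0 : 0 ≤ 3 * (9 / 2 * y ^ 2 + 81 / 16) / (y ^ 2 + 9 / 4) ^ 2 := by positivity
  have hB0 : 0 ≤ (1 / 2 * y ^ 2 + 1 / 16) / (y ^ 2 + 1 / 4) ^ 2 := by positivity
  have e : y ^ 3 * (-ub y) - 2 = (1 / 2 * y ^ 2 + 1 / 16) / (y ^ 2 + 1 / 4) ^ 2
      - 3 * (9 / 2 * y ^ 2 + 81 / 16) / (y ^ 2 + 9 / 4) ^ 2 := by
    rw [ub, neg_sub, mul_sub, eA, eB]; ring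
  have hy2i : 0 < 1 / y ^ 2 := by positivity
  have e30 : (30 : ℝ) / y ^ 2 = 29 / y ^ 2 + 1 / y ^ 2 := by ring
  rw [e, abs_le, e30]
  constructor <;> linarith

/-- `|b − 1/y| ≤ 2/y³` (`y > 0`): `b = arctan v`, `v = y/(y² + 3/4) ∈ [1/y − 3/(4y³), 1/y]`, `v − v³/3 ≤ arctan v ≤ v`. -/
theorem abs_bq_sub_inv_le {y : ℝ} (hy : 0 < y) : |bq y - 1 / y| ≤ 2 / y ^ 3 := by
  -- `arctan t ≤ t` for `t ≥ 0` (folklore; cf. `Literature.NumberTheory.LFunctions.arctan_le_self`)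
  have h_arctan_le : ∀ t : ℝ, 0 ≤ t → Real.arctan t ≤ t := fun t ht ↦ by
    have h := Real.le_tan (Real.arctan_nonneg.2 ht) (Real.arctan_lt_pi_div_two t)
    rwa [Real.tan_arctan] at h
  have h_le_arctan : ∀ t : ℝ, 0 ≤ t → t - t ^ 3 / 3 ≤ Real.arctan t := fun t ht ↦ SmoothReplace.sub_cube_le_arctan ht
  set v : ℝ := y / (y ^ 2 + 3 / 4) with hv
  have hv0 : 0 ≤ v := by positivity
  have hv1 : v ≤ 1 / y := by
    rw [hv, div_le_div_iff₀ (by positivity) hy]; nlinarith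
  have hv2 : 1 / y - 3 / (4 * y ^ 3) ≤ v := by
    have e : 1 / y - 3 / (4 * y ^ 3) = (y ^ 2 - 3 / 4) / y ^ 3 := by
      rw [div_sub_div _ _ (by positivity) (by positivity), div_eq_div_iff (by positivity) (by positivity)]; ring
    rw [e, hv, div_le_div_iff₀ (by positivity) (by positivity)]
    nlinarith [pow_pos hy 2]
  have hv3 : v ^ 3 / 3 ≤ 1 / (3 * y ^ 3) := by
    have : v ^ 3 ≤ (1 / y) ^ 3 := pow_le_pow_left₀ hv0 hv1 3
    simp only [div_pow, one_pow] at this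
    have e : 1 / (3 * y ^ 3) = (1 / y ^ 3) / 3 := by rw [div_div, mul_comm]
    rw [e]; linarith
  have h1 := h_arctan_le v hv0
  have h2 := h_le_arctan v hv0
  have e13 : (2 : ℝ) / y ^ 3 = 3 / (4 * y ^ 3) + 1 / (3 * y ^ 3) + 11 / (12 * y ^ 3) := by field_simp; ring
  have hpos : 0 ≤ 11 / (12 * y ^ 3) := by positivity
  rw [bq, ← hv, abs_le]
  constructor <;> linarith

/-! ### The polar form of the resonant term -/

/-- `z = ((y² + 3/4) + iy)/(y² + 9/4)`: real and imaginary parts. -/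
theorem zq_re_im (y : ℝ) : (zq y).re = (y ^ 2 + 3 / 4) / (y ^ 2 + 9 / 4) ∧ (zq y).im = y / (y ^ 2 + 9 / 4) := by
  have h9 : (y ^ 2 + 9 / 4 : ℝ) ≠ 0 := by positivity
  have hn : Complex.normSq (liRightPt y) = y ^ 2 + 9 / 4 := by
    rw [Complex.normSq_apply]; simp [liRightPt]; ring
  rw [zq_eq_div]
  constructor
  · rw [Complex.div_re, hn]
    simp [liRightPt]
    field_simp
    ring
  · rw [Complex.div_im, hn]
    simp [liRightPt]
    field_simp
    ring

/-- `arg z = b`. -/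
theorem arg_zq (y : ℝ) : Complex.arg (zq y) = bq y := by
  obtain ⟨hre, him⟩ := zq_re_im y
  have hre0 : 0 < (zq y).re := by rw [hre]; positivity
  have harg : |Complex.arg (zq y)| < π / 2 := Complex.abs_arg_lt_pi_div_two_iff.2 (Or.inl hre0)
  have htan : Real.tan (Complex.arg (zq y)) = y / (y ^ 2 + 3 / 4) := by
    rw [Complex.tan_arg, hre, him]
    have h9 : (y ^ 2 + 9 / 4 : ℝ) ≠ 0 := by positivity
    have h3 : (y ^ 2 + 3 / 4 : ℝ) ≠ 0 := by positivity
    field_simp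
  rw [bq, ← htan, Real.arctan_tan (abs_lt.1 harg).1 (abs_lt.1 harg).2]

/-- `|z| = e^{−h}`. -/
theorem norm_zq_eq_exp (y : ℝ) : ‖zq y‖ = Real.exp (-ha y) := by
  have hz : 0 < ‖zq y‖ := norm_pos_iff.2 (zq_ne_zero y)
  have h9 : (0 : ℝ) < y ^ 2 + 9 / 4 := by positivity
  have h4 : (0 : ℝ) < y ^ 2 + 1 / 4 := by positivity
  have hlog : Real.log ‖zq y‖ = -ha y := by
    have h1 : Real.log ((y ^ 2 + 9 / 4) / (y ^ 2 + 1 / 4)) = -Real.log (‖zq y‖ ^ 2) := by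
      rw [norm_zq_sq, ← Real.log_inv, inv_div]
    rw [ha, h1, Real.log_pow]
    push_cast
    ring
  rw [← hlog, Real.exp_log hz]

/-- `2^{−w} = 2^{−3/2} e^{−iy log 2}`. -/
theorem two_cpow_neg_rightPt (y : ℝ) :
    (2 : ℂ) ^ (-liRightPt y) =
      (((2 : ℝ) ^ (-(3 / 2 : ℝ)) : ℝ) : ℂ) * Complex.exp (I * ((-(Real.log 2 * y) : ℝ) : ℂ)) := by
  rw [Complex.cpow_def_of_ne_zero two_ne_zero, Real.rpow_def_of_pos (by norm_num : (0 : ℝ) < 2), Complex.ofReal_exp,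
    ← Complex.exp_add]
  congr 1
  have hlog : Complex.log 2 = ((Real.log 2 : ℝ) : ℂ) := by
    rw [Complex.ofReal_log (by norm_num : (0 : ℝ) ≤ 2)]; norm_num
  rw [hlog]
  unfold liRightPt
  push_cast
  ring

/-- **The polar form of the resonant term**: `Λ(2) 2^{−w} z⁻ⁿ = g(y) e^{iP(y)}`. -/
theorem resonant_polar (n : ℕ) (y : ℝ) :
    (Λ 2 : ℂ) * (2 : ℂ) ^ (-liRightPt y) * (zq y ^ n)⁻¹ = (gA n y : ℂ) * Complex.exp (I * Ph n y) := by
  have hz : zq y = Complex.exp (((-ha y : ℝ) : ℂ) + I * (bq y : ℂ)) := by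
    have h := Complex.norm_mul_exp_arg_mul_I (zq y)
    rw [arg_zq, norm_zq_eq_exp] at h
    rw [← h, Complex.ofReal_exp, ← Complex.exp_add]
    ring_nf
  have hzn : (zq y ^ n)⁻¹ = Complex.exp ((n : ℂ) * (ha y : ℂ) + I * (-((n : ℂ) * (bq y : ℂ)))) := by
    rw [hz, ← Complex.exp_nat_mul, ← Complex.exp_neg]
    congr 1
    push_cast
    ring
  have hΛ : (Λ 2 : ℝ) = Real.log 2 := by
    rw [ArithmeticFunction.vonMangoldt_apply_prime Nat.prime_two]; norm_num
  set A : ℝ := (2 : ℝ) ^ (-(3 / 2 : ℝ)) with hA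
  have h2 := two_cpow_neg_rightPt y
  rw [← hA] at h2
  rw [h2, hzn, gA, Ph, kap, ← hA, hΛ]
  push_cast
  have key : Complex.exp (I * (-((Real.log 2 : ℂ) * (y : ℂ)))) * Complex.exp ((n : ℂ) * (ha y : ℂ) + I * (-((n : ℂ) * (bq y : ℂ))))
      = Complex.exp ((n : ℂ) * (ha y : ℂ)) * Complex.exp (I * (-((Real.log 2 : ℂ) * (y : ℂ)) - (n : ℂ) * (bq y : ℂ))) := by
    rw [← Complex.exp_add, ← Complex.exp_add]
    congr 1
    ring
  linear_combination ((Real.log 2 : ℂ) * (A : ℂ)) * key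

end PrimeEdge

end Summit.RiemannHypothesis.RiemannHypothesis.Theorems.LiTheory
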